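import Summits.CriticalPhenomena.PercolationContinuityZ3.Theorems.PercNearOneGluingNoHeavyQuantOneArmOfSupercritical
import Summits.CriticalPhenomena.PercolationContinuityZ3.Theorems.PercNearOneGluingNoHeavyQuantOneArmOfHalving
import HarnessLib
import HarnessLib.Audit.Tags

/-!
# PAPER-2 track, ARM-3 gen 3 (route E, part 2): the SUPERCRITICAL inputs TYPED as conjectures, an abstract halving-recursion
# lemma, and the sharp-exponent form `(T2 with exponent b) + supercritical halving (exponent ν) ⇒ PolyArm_d(b/ν)` exactly

builds on p205010 (kernel theorem, internal audit signed; external expert review pending).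
Status sentence for p205010: "θ(p_c) = 0 on ℤ^d, all d ≥ 2 — kernel-verified (Lean 4/Mathlib, standard
axioms); internal adversarial audit SIGNED 2026-08-20 04:29Z; external expert review pending."

Seat `prim-quant-arm-3` (gen 3), `--supports stmt-CriticalPhenomena-4575`.  Notation: `P_p = bondPercolation (zdGraph d) p`,
`p_c = criticalProbI d`, `π_p(n) = oneArmProb d p n`, `π^f_p(n) = P_p(0 ↔ ∂Λ_n, 0 ↮ ∞)` (`siteToBoundary d n ∩ (percolatesAt 0)ᶜ`),
`θ(p) = theta (zdGraph d) 0 p`.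

Part 1 (`…QuantOneArmOfSupercritical.lean`, p245983) proved route (E) with unfolded hypotheses and the logarithmic loss "every
`c < b/ν`".  This file

* TYPES the two supercritical inputs, the twins of the lane's subcritical `Quant.SubcriticalArmDecay` /
  `Quant.NearCriticalArmHalving`: `Quant.SupercriticalFiniteClusterDecay d A ν δ₁` (finite-cluster radius decay at correlation
  length `≲ (p − p_c)^{−ν}` on `(p_c, p_c + δ₁)`) and `Quant.SupercriticalArmHalving d A ν κ n₀` (at some `p ∈ (p_c, p_c + A n^{−1/ν}]`,
  `π^f_p(n) ≤ κ · π_{p_c}(⌈n/2⌉)`) — `@[conjecture]` schemas, nothing asserted;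
* proves the abstract **halving-recursion lemma** `Quant.polyDecay_of_halving_recursion`: if `0 ≤ f ≤ 1` on `ℕ` and
  `f(n) ≤ K n^{−θ} + κ f(⌈n/2⌉)` for `n ≥ n₀` with `κ 2^θ < 1`, then `f(n) ≤ max(n₀^θ, K/(1 − κ2^θ)) n^{−θ}` for all `n ≥ 1`
  (the dyadic induction of van Engelenburg–Garban–Panis–Severo §3 / of `oneArmPolyDecayAtCritical_of_armHalving`, isolated for reuse);
* proves the SHARP-EXPONENT supercritical dictionary **`Quant.oneArmPolyDecayAtCritical_of_supercriticalArmHalving`**: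
  `ThetaHolderNearCritical d b B` + `SupercriticalArmHalving d A ν κ n₀` with `κ·2^{b/ν} < 1` ⟹ `∃ C, OneArmPolyDecayAtCritical d (b/ν) C`
  — in exponent language `1/ρ ≥ β/ν` with the endpoint attained (no factor `2`: the supercritical decomposition
  `π_{p_c} ≤ θ(p) + π^f_p` is linear with constant `1`, unlike the entropic bound of the subcritical routes);
* records the typed payoffs `oneArmPolyDecayAtCritical_of_supercriticalFiniteClusterDecay` (every `c < b/ν`, from part 1) and
  `oneArmPolyDecay_of_supercriticalFiniteClusterDecay`.

Honest status: CONDITIONAL dictionary entries; every supercritical input here is OPEN for every `d ≥ 3`, INCLUDING high dimensions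
(the supercritical correlation length `ξ(p) ≍ |p − p_c|^{−1/2}`, `p ↓ p_c`, is conjectural even for `d ≥ 7`: "almost no progress
has been made on the slightly supercritical cases of these conjectures", Hutchcroft 2022 §5; in print for `d ≥ 3` only
`ξ_p ≤ exp(C/(p−p_c)²)`, Duminil-Copin–Kozma–Tassion 2020 Thm. 2, a tree theorem); in `d = 2` they hold (Kesten 1987).  The point
of route (E) is its EXPONENT: `β/ν = 1/ρ` is predicted exact in every dimension (hyperscaling `1/ρ = β/ν = d − d_f` for `d ≤ 6`,
`1/(1/2) = 2` in mean field), whereas the subcritical routes give `(2−γ)/ν` (`≈ 0.24` vs `0.48` in `d = 3`, orientation only).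
Nothing here is a rate for `d = 3`.  Memo: `run/shared/lean/prim/quant/prim-quant-arm-3/POWERLAW-SURVEY.md` §11 (gen 3).

## References
* H. Kesten, Comm. Math. Phys. 109 (1987) 109–156, §1 (`θ(p) ≍ π_{p_c}(L(p))`; scaling relations) [Kesten1987Scaling].
* T. Hutchcroft, *Slightly supercritical percolation on non-amenable graphs I*, Proc. LMS (2022) = arXiv:2002.02916, §5
  (the Euclidean conjectures; "almost no progress … slightly supercritical") [Hutchcroft2022SlightlySupercritical].
* H. Duminil-Copin, G. Kozma, V. Tassion, Progr. Probab. 77 (2020), Thm. 2 [DuminilcopinKozmaTassion2020].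
* D. van Engelenburg, C. Garban, R. Panis, F. Severo, arXiv:2510.21595 (2025), §1.2 (1.25), §3 [VanEngelenburgGarbanPanisSevero2025].
-/

noncomputable section

namespace Summit.CriticalPhenomena.PercolationContinuityZ3.Theorems.Quant

open MeasureTheory Literature.Probability.Percolation Literature.Probability.LatticeModels
open scoped ENNReal

variable {d : ℕ}

/-! ### §1. The supercritical inputs, typed -/

/-- **(E-input) Supercritical finite-cluster radius decay with correlation-length exponent `ν`:** for `p ∈ (p_c, p_c + δ₁)` and
`n ≥ 1`, `P_p(0 ↔ ∂Λ_n, 0 ↮ ∞) ≤ A n^{d−1} exp(−(p − p_c)^ν n / A)` — the twin above `p_c` of `Quant.SubcriticalArmDecay` (as would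
follow from a truncated two-point bound `τ^f_p(0,x) ≤ e^{−‖x‖/ξ(p)}` with `ξ(p) ≤ A (p − p_c)^{−ν}` and a union bound over `∂Λ_n`).
OPEN for every `d ≥ 3`, high dimensions included (conjecturally `ν = 1/2` there); in print only `ξ_p ≤ exp(C/(p − p_c)²)`
(Duminil-Copin–Kozma–Tassion 2020, Thm. 2; tree theorem `DuminilcopinKozmaTassion2020_thm2_supercritical_holds`).  Typed, not asserted.
[cite: DuminilcopinKozmaTassion2020, Thm. 2 (the supercritical correlation length ξ_p)]
[cite: Hutchcroft2022SlightlySupercritical, §5 (conjecture ξ(p) ≍ |p−p_c|^{−1/2}, p > p_c, d ≥ 7)] -/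
@[conjecture] def SupercriticalFiniteClusterDecay (d : ℕ) (A ν δ₁ : ℝ) : Prop :=
  ∀ p : unitInterval, (criticalProbI d : ℝ) < p → (p : ℝ) < criticalProbI d + δ₁ → ∀ n : ℕ, 1 ≤ n →
    (bondPercolation (zdGraph d) p).real (siteToBoundary d n ∩ (percolatesAt (0 : Site d))ᶜ) ≤
      A * (n : ℝ) ^ ((d : ℝ) - 1) * Real.exp (-(((p : ℝ) - criticalProbI d) ^ ν * n) / A)

/-- **(E′-input) Supercritical arm HALVING at the correlation scale, exponent `ν`, factor `κ`:** for every `n ≥ n₀` there is a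
supercritical parameter `p` with `p_c < p` and `p − p_c ≤ A n^{−1/ν}` at which the TRUNCATED arm probability at scale `n` is at most
`κ` times the critical arm probability at scale `⌈n/2⌉`: `P_p(0 ↔ ∂Λ_n, 0 ↮ ∞) ≤ κ · π_{p_c}(⌈n/2⌉)` — the twin above `p_c` of
`Quant.NearCriticalArmHalving` (as would follow from a supercritical sharp-length bound for the finite clusters and the BK
decomposition).  OPEN for every `d ≥ 3`; typed, not asserted.
[cite: VanEngelenburgGarbanPanisSevero2025, §1.2 eq. (1.25) (the subcritical halving input)] [cite: Kesten1987Scaling, §1] -/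
@[conjecture] def SupercriticalArmHalving (d : ℕ) (A ν κ : ℝ) (n₀ : ℕ) : Prop :=
  ∀ n : ℕ, n₀ ≤ n → ∃ p : unitInterval, (criticalProbI d : ℝ) < p ∧
    (p : ℝ) - criticalProbI d ≤ A * (n : ℝ) ^ (-(1 / ν)) ∧
    (bondPercolation (zdGraph d) p).real (siteToBoundary d n ∩ (percolatesAt (0 : Site d))ᶜ) ≤
      κ * oneArmProb d (criticalProbI d) ((n + 1) / 2)

/-! ### §2. The abstract halving recursion -/

/-- **Halving recursion ⇒ power decay.**  Let `f : ℕ → ℝ` with `f(n) ≤ 1`, and suppose `f(n) ≤ K n^{−θ} + κ f(⌈n/2⌉)` for all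
`n ≥ n₀` (`n₀ ≥ 1`), where `θ > 0`, `κ ≥ 0` and `κ·2^θ < 1`.  Then `f(n) ≤ C n^{−θ}` for all `n ≥ 1` with
`C = max(n₀^θ, K/(1 − κ2^θ))`: strong induction, `f(⌈n/2⌉) ≤ C (n/2)^{−θ} = C 2^θ n^{−θ}` and `K + κ2^θ C ≤ C`.  The dyadic induction
of van Engelenburg–Garban–Panis–Severo §3 (there with `√θ_n`), isolated.  [folklore]
[cite: VanEngelenburgGarbanPanisSevero2025, §3 (dyadic induction for θ_n)] -/
theorem polyDecay_of_halving_recursion (f : ℕ → ℝ) (hf1 : ∀ n, f n ≤ 1) {θ K κ : ℝ} (hθ : 0 < θ)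
    (hκ : 0 ≤ κ) (hsmall : κ * (2 : ℝ) ^ θ < 1) {n₀ : ℕ} (hn₀ : 1 ≤ n₀)
    (hrec : ∀ n : ℕ, n₀ ≤ n → f n ≤ K * (n : ℝ) ^ (-θ) + κ * f ((n + 1) / 2)) :
    ∀ n : ℕ, 1 ≤ n → f n ≤ max ((n₀ : ℝ) ^ θ) (K / (1 - κ * (2 : ℝ) ^ θ)) * (n : ℝ) ^ (-θ) := by
  set C : ℝ := max ((n₀ : ℝ) ^ θ) (K / (1 - κ * (2 : ℝ) ^ θ)) with hC
  have h2θ : (1 : ℝ) ≤ (2 : ℝ) ^ θ := Real.one_le_rpow (by norm_num) hθ.le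
  have hden : 0 < 1 - κ * (2 : ℝ) ^ θ := by linarith
  have hn₀R : (1 : ℝ) ≤ n₀ := by exact_mod_cast hn₀
  have hC1 : (n₀ : ℝ) ^ θ ≤ C := le_max_left _ _
  have hC2 : K / (1 - κ * (2 : ℝ) ^ θ) ≤ C := le_max_right _ _
  have hC0 : 0 ≤ C := le_trans (Real.rpow_nonneg (by linarith) _) hC1
  have hKC : K + κ * (2 : ℝ) ^ θ * C ≤ C := by
    have := (div_le_iff₀ hden).1 hC2
    nlinarith
  -- strong induction
  intro n
  induction n using Nat.strong_induction_on with
  | _ n ih =>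
    intro hn
    have hnR : (0 : ℝ) < n := by exact_mod_cast hn
    have hnθ : 0 < (n : ℝ) ^ (-θ) := Real.rpow_pos_of_pos hnR _
    by_cases hsmalln : n < n₀ ∨ n = 1
    · -- `f n ≤ 1 ≤ n₀^θ n^{-θ} ≤ C n^{-θ}`
      have hle : (n : ℝ) ≤ n₀ := by
        rcases hsmalln with h | h
        · exact_mod_cast h.le
        · rw [h]; exact_mod_cast hn₀
      have h1 : 1 ≤ (n₀ : ℝ) ^ θ * (n : ℝ) ^ (-θ) := by
        rw [Real.rpow_neg hnR.le, ← div_eq_mul_inv, le_div_iff₀ (Real.rpow_pos_of_pos hnR _), one_mul]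
        exact Real.rpow_le_rpow hnR.le hle hθ.le
      calc f n ≤ 1 := hf1 n
        _ ≤ (n₀ : ℝ) ^ θ * (n : ℝ) ^ (-θ) := h1
        _ ≤ C * (n : ℝ) ^ (-θ) := mul_le_mul_of_nonneg_right hC1 hnθ.le
    · push Not at hsmalln
      obtain ⟨hnn₀, hn1⟩ := hsmalln
      have hn2 : 2 ≤ n := by omega
      set m : ℕ := (n + 1) / 2 with hm
      have hm1 : 1 ≤ m := by omega
      have hmn : m < n := by omega
      have hfm := ih m hmn hm1
      have hmR : (n : ℝ) / 2 ≤ m := half_le_cast_succ_div_two n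
      have hm0 : (0 : ℝ) < m := by exact_mod_cast hm1
      -- `m^{-θ} ≤ (n/2)^{-θ} = 2^θ n^{-θ}`
      have hmθ : (m : ℝ) ^ (-θ) ≤ (2 : ℝ) ^ θ * (n : ℝ) ^ (-θ) := by
        have h1 : (m : ℝ) ^ (-θ) ≤ ((n : ℝ) / 2) ^ (-θ) :=
          Real.rpow_le_rpow_of_nonpos (by positivity) hmR (by linarith)
        have h2 : ((n : ℝ) / 2) ^ (-θ) = (2 : ℝ) ^ θ * (n : ℝ) ^ (-θ) := by
          rw [Real.div_rpow hnR.le (by norm_num : (0 : ℝ) ≤ 2), Real.rpow_neg (by norm_num : (0 : ℝ) ≤ 2) θ,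
            div_inv_eq_mul, mul_comm]
        rw [← h2]; exact h1
      calc f n ≤ K * (n : ℝ) ^ (-θ) + κ * f m := hrec n hnn₀
        _ ≤ K * (n : ℝ) ^ (-θ) + κ * (C * (m : ℝ) ^ (-θ)) := by gcongr
        _ ≤ K * (n : ℝ) ^ (-θ) + κ * (C * ((2 : ℝ) ^ θ * (n : ℝ) ^ (-θ))) := by gcongr
        _ = (K + κ * (2 : ℝ) ^ θ * C) * (n : ℝ) ^ (-θ) := by ring
        _ ≤ C * (n : ℝ) ^ (-θ) := mul_le_mul_of_nonneg_right hKC hnθ.le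

/-! ### §3. The sharp-exponent supercritical dictionary -/

/-- The constant of a `ThetaHolderNearCritical d b B` instance is nonnegative (test at `p = 1`, where `1 − p_c > 0`). [folklore] -/
theorem thetaHolderNearCritical_const_nonneg (hd : 2 ≤ d) {b B : ℝ} (hθ : ThetaHolderNearCritical d b B) : 0 ≤ B := by
  have hpc1 : (criticalProbI d : ℝ) < 1 := by rw [coe_criticalProbI]; exact criticalProb_zd_lt_one hd
  have h1 := hθ 1 (by exact_mod_cast (criticalProbI d).2.2)
  have hθ1 : 0 ≤ theta (zdGraph d) 0 1 := by unfold theta; exact measureReal_nonneg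
  have hpow : 0 < ((1 : unitInterval) : ℝ) - criticalProbI d := by push_cast; linarith
  have hpow' : 0 < (((1 : unitInterval) : ℝ) - criticalProbI d) ^ b := Real.rpow_pos_of_pos hpow b
  by_contra hB; push Not at hB
  have : B * (((1 : unitInterval) : ℝ) - criticalProbI d) ^ b < 0 := mul_neg_of_neg_of_pos hB hpow'
  linarith

/-- **ROUTE E′ (kernel dictionary, sharp exponent): `ThetaHolderNearCritical d b B` + `SupercriticalArmHalving d A ν κ n₀` with
`κ·2^{b/ν} < 1` (`b, ν > 0`, `A, κ ≥ 0`) ⟹ `∃ C, OneArmPolyDecayAtCritical d (b/ν) C`.**  Proof: at the halving parameter `p = p_n`,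
`π_{p_c}(n) ≤ π_p(n) ≤ θ(p) + π^f_p(n) ≤ B (A n^{−1/ν})^b + κ π_{p_c}(⌈n/2⌉) = B A^b n^{−b/ν} + κ π_{p_c}(⌈n/2⌉)`, and
`polyDecay_of_halving_recursion`.  In exponent language `1/ρ ≥ β/ν` with the endpoint attained — Kesten's scaling relation read in one
direction, predicted SHARP in every dimension.  CONDITIONAL: both inputs OPEN for every `d ≥ 3` (high `d` included for the halving input).
New as a kernel implication.  [cite: Kesten1987Scaling, §1 (θ(p) ≍ π_{p_c}(L(p)); 1/ρ = β/ν in d = 2)]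
[cite: VanEngelenburgGarbanPanisSevero2025, §3 (dyadic induction)] -/
theorem oneArmPolyDecayAtCritical_of_supercriticalArmHalving (hd : 2 ≤ d) {A ν κ B b : ℝ} {n₀ : ℕ} (hν : 0 < ν) (hb : 0 < b)
    (hA : 0 ≤ A) (hκ : 0 ≤ κ) (hsmall : κ * (2 : ℝ) ^ (b / ν) < 1)
    (hθ : ThetaHolderNearCritical d b B) (hH : SupercriticalArmHalving d A ν κ n₀) :
    ∃ C : ℝ, OneArmPolyDecayAtCritical d (b / ν) C := by
  have hB := thetaHolderNearCritical_const_nonneg hd hθ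
  set θ' : ℝ := b / ν with hθ'
  have hθ'0 : 0 < θ' := div_pos hb hν
  set f : ℕ → ℝ := fun n => oneArmProb d (criticalProbI d) n with hf
  have hf1 : ∀ n, f n ≤ 1 := fun n => by simp only [hf]; unfold oneArmProb; exact measureReal_le_one
  set n₁ : ℕ := max n₀ 1 with hn₁
  have hn₁1 : 1 ≤ n₁ := le_max_right _ _
  have hrec : ∀ n : ℕ, n₁ ≤ n → f n ≤ B * A ^ b * (n : ℝ) ^ (-θ') + κ * f ((n + 1) / 2) := by
    intro n hn
    have hn0 : (0 : ℝ) < n := by exact_mod_cast hn₁1.trans hn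
    obtain ⟨p, hp1, hp2, hp3⟩ := hH n ((le_max_left _ _).trans hn)
    have hpge : criticalProbI d ≤ p := (Subtype.coe_lt_coe.1 hp1).le
    have hs0 : 0 < (p : ℝ) - criticalProbI d := by linarith
    -- `θ(p) ≤ B (p - p_c)^b ≤ B (A n^{-1/ν})^b = B A^b n^{-θ'}`
    have hth : theta (zdGraph d) 0 p ≤ B * A ^ b * (n : ℝ) ^ (-θ') := by
      have h1 := hθ p hpge
      have h2 : ((p : ℝ) - criticalProbI d) ^ b ≤ (A * (n : ℝ) ^ (-(1 / ν))) ^ b :=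
        Real.rpow_le_rpow hs0.le hp2 hb.le
      have h3 : (A * (n : ℝ) ^ (-(1 / ν))) ^ b = A ^ b * (n : ℝ) ^ (-θ') := by
        rw [Real.mul_rpow hA (Real.rpow_nonneg hn0.le _), ← Real.rpow_mul hn0.le, hθ']
        congr 1; ring
      calc theta (zdGraph d) 0 p ≤ B * ((p : ℝ) - criticalProbI d) ^ b := h1
        _ ≤ B * (A * (n : ℝ) ^ (-(1 / ν))) ^ b := mul_le_mul_of_nonneg_left h2 hB
        _ = B * A ^ b * (n : ℝ) ^ (-θ') := by rw [h3]; ring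
    calc f n = oneArmProb d (criticalProbI d) n := rfl
      _ ≤ oneArmProb d p n := oneArmProb_criticalProbI_le_of_le hpge n
      _ ≤ theta (zdGraph d) 0 p +
            (bondPercolation (zdGraph d) p).real (siteToBoundary d n ∩ (percolatesAt (0 : Site d))ᶜ) :=
          oneArmProb_le_theta_add_truncated p n
      _ ≤ B * A ^ b * (n : ℝ) ^ (-θ') + κ * oneArmProb d (criticalProbI d) ((n + 1) / 2) := add_le_add hth hp3
      _ = B * A ^ b * (n : ℝ) ^ (-θ') + κ * f ((n + 1) / 2) := rfl
  have hmain := polyDecay_of_halving_recursion f hf1 hθ'0 hκ hsmall hn₁1 hrec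
  exact ⟨_, fun n hn => hmain n hn⟩

/-- Existential form of route E′.  CONDITIONAL. [cite: Kesten1987Scaling, §1] -/
theorem oneArmPolyDecay_of_supercriticalArmHalving (hd : 2 ≤ d) {A ν κ B b : ℝ} {n₀ : ℕ} (hν : 0 < ν) (hb : 0 < b)
    (hA : 0 ≤ A) (hκ : 0 ≤ κ) (hsmall : κ * (2 : ℝ) ^ (b / ν) < 1)
    (hθ : ThetaHolderNearCritical d b B) (hH : SupercriticalArmHalving d A ν κ n₀) : OneArmPolyDecay d := by
  obtain ⟨C, hC⟩ := oneArmPolyDecayAtCritical_of_supercriticalArmHalving hd hν hb hA hκ hsmall hθ hH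
  exact ⟨b / ν, div_pos hb hν, C, hC⟩

/-! ### §4. Typed payoffs of part 1 -/

/-- **`SupercriticalFiniteClusterDecay d A ν δ₁` + `ThetaHolderNearCritical d b B` ⟹ `∃ C, OneArmPolyDecayAtCritical d c C` for every
`0 < c < b/ν`** (part 1's `oneArmPolyDecayAtCritical_of_supercriticalInputs` on the typed input).  CONDITIONAL; both inputs open for
every `d ≥ 3`. [cite: Kesten1987Scaling, §1] -/
theorem oneArmPolyDecayAtCritical_of_supercriticalFiniteClusterDecay (hd : 2 ≤ d) {A ν δ₁ B b : ℝ} (hν : 0 < ν) (hb : 0 < b)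
    (hδ₁ : 0 < δ₁) (hFin : SupercriticalFiniteClusterDecay d A ν δ₁) (hθ : ThetaHolderNearCritical d b B)
    {c : ℝ} (hc0 : 0 < c) (hc : c < b / ν) :
    ∃ C : ℝ, OneArmPolyDecayAtCritical d c C :=
  oneArmPolyDecayAtCritical_of_supercriticalInputs hd hν hb hδ₁ hFin hθ hc0 hc

/-- Existential form: `SupercriticalFiniteClusterDecay d A ν δ₁` + `ThetaHolderNearCritical d b B` ⟹ `OneArmPolyDecay d`.  CONDITIONAL.
[cite: Kesten1987Scaling, §1] -/
theorem oneArmPolyDecay_of_supercriticalFiniteClusterDecay (hd : 2 ≤ d) {A ν δ₁ B b : ℝ} (hν : 0 < ν) (hb : 0 < b)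
    (hδ₁ : 0 < δ₁) (hFin : SupercriticalFiniteClusterDecay d A ν δ₁) (hθ : ThetaHolderNearCritical d b B) :
    OneArmPolyDecay d :=
  oneArmPolyDecay_of_supercriticalInputs hd hν hb hδ₁ hFin hθ

end Summit.CriticalPhenomena.PercolationContinuityZ3.Theorems.Quant

end
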